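import Mathlib
import Summits.MatrixMultiplication.Statement
import Summits.MatrixMultiplication.MatrixMultiplication.Theorems.GraphEquationsLadderDial

/-!
# Graph equations — HASSE–SCHMIDT AD: the tight dial is QUADRATIC, not geometric (M21a, decomp-mm-lens-5 g34)

(supports `MultiplicityReduction`, stmt-MatrixMultiplication-27806; companion of `GraphEquationsLadderDial`
(M20a), `GraphEquationsDeepDeflation` (M19d), `GraphEquationsExactEngineTwo` (M19m).  No new definition.)

Lens 5 measures the membership-exponent ladder by the RUNG COST `Φ(e)`.  On TIGHT systems (tests in
`I^{e-1}`) M20a proved every rung with the GEOMETRIC constant `Φ(k+2) = 6·4^k` (`k` first-order deflations,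
each quadrupling the program), whence «log-growth purification».  Here the iterated first-order deflation is
replaced by ONE HIGHER-ORDER MOVE — forward AD of a HASSE–SCHMIDT DERIVATION, i.e. the Taylor expansion
`t(a,b,c + s·𝟙) = Σ_j s^j·T_j t` along the constant vertical field — and the rung cost becomes QUADRATIC:

* `IsNonscalarSeq.hasse_affine` — **COST OF TAYLOR MODES** in Ostrowski's model: for any algebra hom
  `Θ : ℂ[X] → ℂ[X][s]` with cost-free coefficients on the variables, the modes `[s^j]Θp`, `j ≤ k`, of the free
  elements of a nonscalar sequence of length `N` are free over one of length `≤ binom(k+2,2)·N` (a product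
  `u·v` becomes the products `[s^i]Θu·[s^l]Θv`, `i+l ≤ k`; iterating a derivation `k` times costs `3^k`, M20c).
* `hasse_coeff_mem_pow` — a Hasse–Schmidt derivation (`[s^0]Θ = id`) lowers `I`-adic order by at most the
  mode: `t ∈ I^d ⇒ [s^l]Θt ∈ I^{d-l}` (any ideal `I`).
* `exists_verticalHasse` — the vertical Taylor substitution `c_q ↦ c_q + s` is such a `Θ`, `Θ f_q = s + f_q`.
* `sq_mem_span_hasseModes` — **TIGHT MEMBERS DROP TO SQUARES IN ONE MOVE**: `f_q^{k+2} ∈ (t_o)_o ⇒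
  f_q² ∈ ([s^l]Θt_o)_{l ≤ k, o}` (`[s^k](s + f_q)^{k+2} = binom(k+2,2)·f_q²`).
* `tensorRank_le_of_sqMembers_family` — the `e = 2` exact engine (M19m) for an arbitrary finite test FAMILY in
  `I` of nonscalar length `≤ N` with `f_q² ∈ (t)`: `R(⟨n,n,n⟩) ≤ 6N` (translate to a max-rank base).
* `rankRung_tight_choose` — **EVERY RUNG ON TIGHT SYSTEMS AT QUADRATIC COST `Φ(k+2) = 6·binom(k+2,2)`**:
  tests in `I^{k+1}` and `f_q^{k+2} ∈ J_E` give `R(⟨n,n,n⟩) ≤ 6·binom(k+2,2)·cost E` (was `6·4^k·(cost E + n²)`;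
  `k = 1` recovers the `× 3` of one deflation).
* `omega_le_of_tight_polyGrowth` / `eqAdmissibleRed_of_tight_polyGrowth` — **POLYNOMIAL-GROWTH
  PURIFICATION** (unconditional): correct tight families with `binom(k_n+2,2)·cost E_n ≤ c·n^β` force
  `ω ≤ β` — the membership exponent may grow like a POWER of `n` (`e_n ≲ n^{δ/2}` is absorbed by `β + δ`),
  where M20a allowed `log n`.
-/

set_option linter.dupNamespace false

noncomputable section

open scoped BigOperators

namespace Summit.MatrixMultiplication.MatrixMultiplication.Theorems.GraphEquations

open MvPolynomial
open Literature.Computability.AlgebraicComplexity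
open Literature.Computability.AlgebraicComplexity.ArithCircuit

variable {n : ℕ}

/-! ## Hasse–Schmidt AD in Ostrowski's model -/

section Hasse

variable {σ : Type*}

/-- Prepending products of free elements keeps a nonscalar sequence. -/
theorem IsNonscalarSeq.prepend_products {gs ps : List (MvPolynomial σ ℂ)} (hgs : IsNonscalarSeq gs)
    (hps : ∀ p ∈ ps, ∃ u ∈ freeSpan {x | x ∈ gs}, ∃ v ∈ freeSpan {x | x ∈ gs}, p = u * v) :
    IsNonscalarSeq (ps ++ gs) := by
  induction ps with
  | nil => simpa using hgs
  | cons p ps ih =>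
    obtain ⟨u, hu, v, hv, rfl⟩ := hps p List.mem_cons_self
    have hmono : freeSpan {x | x ∈ gs} ≤ freeSpan {x | x ∈ ps ++ gs} :=
      freeSpan_mono fun x hx => by
        simp only [Set.mem_setOf_eq, List.mem_append] at hx ⊢; exact Or.inr hx
    exact ⟨ih fun p' hp' => hps p' (List.mem_cons_of_mem _ hp'), u, hmono hu, v, hmono hv, rfl⟩

/-- The triangle `{(i,l) : i + l ≤ k}`, listed by antidiagonals, has `binom(k+2,2)` elements. -/
theorem length_flatMap_antidiagonal {α : Type*} (f : ℕ × ℕ → α) (k : ℕ) :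
    ((List.range (k + 1)).flatMap fun j => (Finset.HasAntidiagonal.antidiagonal j).toList.map f).length =
      (k + 2).choose 2 := by
  induction k with
  | zero =>
    rw [List.range_succ, List.range_zero, List.nil_append, List.flatMap_cons, List.flatMap_nil,
      List.append_nil, List.length_map, Finset.length_toList, Finset.Nat.card_antidiagonal]
    rfl
  | succ k ih =>
    rw [List.range_succ, List.flatMap_append, List.length_append, ih, List.flatMap_cons,
      List.flatMap_nil, List.append_nil, List.length_map, Finset.length_toList,
      Finset.Nat.card_antidiagonal, show k + 1 + 2 = (k + 2) + 1 from rfl,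
      Nat.choose_succ_succ (k + 2) 1, Nat.choose_one_right]
    ring

/-- The `j`-th Taylor mode of a free element lies in a submodule containing the modes of `1`, of the
variables and of the given elements. -/
theorem hasseMode_mem_of_mem_freeSpan (Θ : MvPolynomial σ ℂ →ₐ[ℂ] Polynomial (MvPolynomial σ ℂ))
    (j : ℕ) {S : Set (MvPolynomial σ ℂ)} {M : Submodule ℂ (MvPolynomial σ ℂ)}
    (h1 : (Θ 1).coeff j ∈ M) (hX : ∀ w, (Θ (X w)).coeff j ∈ M) (hS : ∀ s ∈ S, (Θ s).coeff j ∈ M)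
    {p : MvPolynomial σ ℂ} (hp : p ∈ freeSpan S) : (Θ p).coeff j ∈ M := by
  induction hp using Submodule.span_induction with
  | mem x hx =>
    rcases hx with rfl | ⟨i, rfl⟩ | hx
    · exact h1
    · exact hX i
    · exact hS x hx
  | zero => simp
  | add x y _ _ hx hy => simpa only [map_add, Polynomial.coeff_add] using add_mem hx hy
  | smul a x _ hx =>
    rw [smul_eq_C_mul, map_mul, MvPolynomial.algHom_C, Polynomial.algebraMap_apply,
      MvPolynomial.algebraMap_eq, Polynomial.coeff_C_mul, ← smul_eq_C_mul]
    exact M.smul_mem a hx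

/-- **HASSE–SCHMIDT AD, `× binom(k+2,2)`.**  Let `Θ : ℂ[X_σ] → ℂ[X_σ][s]` be an algebra hom whose values
on the variables have cost-free coefficients (e.g. a Taylor substitution `X ↦ X + s·(affine)`).  The MODES
`[s^j]Θp`, `j ≤ k`, of the free elements of a nonscalar sequence `gs` are free over a nonscalar sequence
of length `≤ binom(k+2,2)·|gs|`: each product `u·v` is replaced by the products `[s^i]Θu · [s^l]Θv`,
`i + l ≤ k` (Leibniz–Cauchy `[s^j]Θ(uv) = Σ_{i+l=j} [s^i]Θu·[s^l]Θv`). -/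
theorem IsNonscalarSeq.hasse_affine (Θ : MvPolynomial σ ℂ →ₐ[ℂ] Polynomial (MvPolynomial σ ℂ))
    (hΘ : ∀ (w : σ) (j : ℕ), (Θ (X w)).coeff j ∈ freeSpan (∅ : Set (MvPolynomial σ ℂ))) (k : ℕ)
    {gs : List (MvPolynomial σ ℂ)} (hgs : IsNonscalarSeq gs) :
    ∃ gs' : List (MvPolynomial σ ℂ), IsNonscalarSeq gs' ∧
      gs'.length ≤ (k + 2).choose 2 * gs.length ∧
      ∀ p ∈ freeSpan {x | x ∈ gs}, ∀ j ≤ k, (Θ p).coeff j ∈ freeSpan {x | x ∈ gs'} := by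
  classical
  have h1 : ∀ (j : ℕ) (M : Submodule ℂ (MvPolynomial σ ℂ)), (1 : MvPolynomial σ ℂ) ∈ M →
      (Θ 1).coeff j ∈ M := by
    intro j M hM
    rw [map_one, Polynomial.coeff_one]
    split_ifs
    exacts [hM, M.zero_mem]
  induction gs with
  | nil =>
    refine ⟨[], isNonscalarSeq_nil, by simp, fun p hp j _ => ?_⟩
    refine hasseMode_mem_of_mem_freeSpan Θ j (h1 j _ (one_mem_freeSpan _))
      (fun w => freeSpan_mono (Set.empty_subset _) (hΘ w j)) (fun s hs => ?_) hp
    simp at hs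
  | cons g gs ih =>
    obtain ⟨hgs0, u, hu, v, hv, rfl⟩ := hgs
    obtain ⟨gs', hns', hlen', hT⟩ := ih hgs0
    set ps : List (MvPolynomial σ ℂ) := (List.range (k + 1)).flatMap fun j =>
      (Finset.HasAntidiagonal.antidiagonal j).toList.map fun il => (Θ u).coeff il.1 * (Θ v).coeff il.2 with hps
    have hmem_ps : ∀ j ≤ k, ∀ il ∈ Finset.HasAntidiagonal.antidiagonal j,
        (Θ u).coeff il.1 * (Θ v).coeff il.2 ∈ ps := by
      intro j hj il hil
      rw [hps, List.mem_flatMap]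
      exact ⟨j, List.mem_range.mpr (by omega), List.mem_map.mpr ⟨il, Finset.mem_toList.mpr hil, rfl⟩⟩
    have hns'' : IsNonscalarSeq (ps ++ gs') := by
      refine IsNonscalarSeq.prepend_products hns' fun p hp => ?_
      rw [hps, List.mem_flatMap] at hp
      obtain ⟨j, hj, hp⟩ := hp
      rw [List.mem_map] at hp
      obtain ⟨il, hil, rfl⟩ := hp
      rw [List.mem_range] at hj
      rw [Finset.mem_toList, Finset.HasAntidiagonal.mem_antidiagonal] at hil
      exact ⟨_, hT u hu il.1 (by omega), _, hT v hv il.2 (by omega), rfl⟩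
    have hmono : freeSpan {x | x ∈ gs'} ≤ freeSpan {x | x ∈ ps ++ gs'} :=
      freeSpan_mono fun x hx => by
        simp only [Set.mem_setOf_eq, List.mem_append] at hx ⊢; exact Or.inr hx
    refine ⟨ps ++ gs', hns'', ?_, fun p hp j hj => ?_⟩
    · rw [List.length_append, hps, length_flatMap_antidiagonal, List.length_cons]
      calc (k + 2).choose 2 + gs'.length ≤ (k + 2).choose 2 + (k + 2).choose 2 * gs.length :=
            Nat.add_le_add_left hlen' _
        _ = (k + 2).choose 2 * (gs.length + 1) := by ring
    · refine hasseMode_mem_of_mem_freeSpan Θ j (h1 j _ (one_mem_freeSpan _))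
        (fun w => freeSpan_mono (Set.empty_subset _) (hΘ w j)) (fun s hs => ?_) hp
      simp only [Set.mem_setOf_eq, List.mem_cons] at hs
      rcases hs with rfl | hs
      · rw [map_mul, Polynomial.coeff_mul]
        exact Submodule.sum_mem _ fun il hil =>
          mem_freeSpan_of_mem (List.mem_append_left _ (hmem_ps j hj il hil))
      · exact hmono (hT s (mem_freeSpan_of_mem hs) j hj)

/-- **A Hasse–Schmidt derivation lowers `I`-adic order by at most the mode**: if `[s^0]Θ = id` then
`t ∈ I^d ⇒ [s^l]Θt ∈ I^{d-l}` for every ideal `I` (Leibniz–Cauchy and induction on `d`). -/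
theorem hasse_coeff_mem_pow (Θ : MvPolynomial σ ℂ →ₐ[ℂ] Polynomial (MvPolynomial σ ℂ))
    (h0 : ∀ p, (Θ p).coeff 0 = p) (I : Ideal (MvPolynomial σ ℂ)) :
    ∀ (d : ℕ) {t : MvPolynomial σ ℂ}, t ∈ I ^ d → ∀ l : ℕ, (Θ t).coeff l ∈ I ^ (d - l)
  | 0, t, _, l => by simp
  | d + 1, t, ht, l => by
    rw [pow_succ'] at ht
    refine Submodule.mul_induction_on ht (fun m hm r hr => ?_) (fun x y hx hy => ?_)
    · rw [map_mul, Polynomial.coeff_mul]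
      refine Ideal.sum_mem _ fun il hil => ?_
      rw [Finset.HasAntidiagonal.mem_antidiagonal] at hil
      rcases Nat.eq_zero_or_pos il.1 with h | h
      · have h2 : il.2 = l := by omega
        rw [h, h0, h2]
        have hprod := Ideal.mul_mem_mul hm (hasse_coeff_mem_pow Θ h0 I d hr l)
        rw [← pow_succ'] at hprod
        exact Ideal.pow_le_pow_right (by omega) hprod
      · exact Ideal.pow_le_pow_right (by omega)
          (Ideal.mul_mem_left _ _ (hasse_coeff_mem_pow Θ h0 I d hr il.2))
    · rw [map_add, Polynomial.coeff_add]
      exact Ideal.add_mem _ hx hy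

end Hasse

/-! ## The vertical Hasse–Schmidt derivation of `ℂ[a,b,c]` -/

/-- **The vertical Taylor substitution** `a, b ↦ a, b`, `c_q ↦ c_q + s`: an algebra hom
`Θ : ℂ[a,b,c] → ℂ[a,b,c][s]` with `[s^0]Θ = id`, cost-free coefficients on the variables, and
`Θ f_q = s + f_q` for every generator. -/
theorem exists_verticalHasse (n : ℕ) :
    ∃ Θ : MvPolynomial (GraphVars n) ℂ →ₐ[ℂ] Polynomial (MvPolynomial (GraphVars n) ℂ),
      (∀ p, (Θ p).coeff 0 = p) ∧
      (∀ (x : GraphVars n) (j : ℕ),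
        (Θ (X x)).coeff j ∈ freeSpan (∅ : Set (MvPolynomial (GraphVars n) ℂ))) ∧
      (∀ q : Fin n × Fin n, Θ (generator n q) = Polynomial.X + Polynomial.C (generator n q)) := by
  let θ : GraphVars n → Polynomial (MvPolynomial (GraphVars n) ℂ) := fun x =>
    Polynomial.C (X x) + Sum.elim (fun _ => 0) (fun _ => Polynomial.X) x
  refine ⟨MvPolynomial.aeval θ, fun p => ?_, fun x j => ?_, fun q => ?_⟩
  · have hθ0 : ∀ x : GraphVars n, (θ x).coeff 0 = X x := by
      intro x
      rcases x with x | x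
      · simp [θ]
      · simp [θ]
    induction p using MvPolynomial.induction_on with
    | C c =>
      rw [MvPolynomial.algHom_C, Polynomial.algebraMap_apply, MvPolynomial.algebraMap_eq,
        Polynomial.coeff_C_zero]
    | add p q hp hq => rw [map_add, Polynomial.coeff_add, hp, hq]
    | mul_X p x hp => rw [map_mul, MvPolynomial.aeval_X, Polynomial.mul_coeff_zero, hp, hθ0]
  · rcases x with x | x
    · simp only [MvPolynomial.aeval_X, θ, Sum.elim_inl, add_zero, Polynomial.coeff_C]
      split_ifs
      exacts [X_mem_freeSpan _ _, Submodule.zero_mem _]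
    · simp only [MvPolynomial.aeval_X, θ, Sum.elim_inr, Polynomial.coeff_add, Polynomial.coeff_C,
        Polynomial.coeff_X]
      refine Submodule.add_mem _ ?_ ?_ <;> split_ifs
      exacts [X_mem_freeSpan _ _, Submodule.zero_mem _, one_mem_freeSpan _, Submodule.zero_mem _]
  · simp only [generator, map_sub, map_sum, map_mul, MvPolynomial.aeval_X, θ, Sum.elim_inl,
      Sum.elim_inr, add_zero]
    ring

/-- **TIGHT MEMBERS DROP TO SQUARES IN ONE MOVE.**  If `Θ f_q = s + f_q` and `f_q^{k+2} = Σ_o h_o t_o`,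
then `f_q²` is a combination of the modes `[s^l]Θ t_o`, `l ≤ k`
(`[s^k]`: `binom(k+2,2)·f_q² = Σ_o Σ_{i+l=k} [s^i]Θh_o · [s^l]Θt_o`). -/
theorem sq_mem_span_hasseModes
    (Θ : MvPolynomial (GraphVars n) ℂ →ₐ[ℂ] Polynomial (MvPolynomial (GraphVars n) ℂ))
    (h2 : ∀ q : Fin n × Fin n, Θ (generator n q) = Polynomial.X + Polynomial.C (generator n q))
    (k : ℕ) {ι : Type*} [Fintype ι] (t : ι → MvPolynomial (GraphVars n) ℂ) {q : Fin n × Fin n}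
    (hmem : generator n q ^ (k + 2) ∈ Ideal.span (Set.range t)) :
    generator n q ^ 2 ∈
      Ideal.span (Set.range fun lo : Fin (k + 1) × ι => (Θ (t lo.2)).coeff (lo.1 : ℕ)) := by
  classical
  set J := Ideal.span (Set.range fun lo : Fin (k + 1) × ι => (Θ (t lo.2)).coeff (lo.1 : ℕ)) with hJ
  obtain ⟨h, hh⟩ := Ideal.mem_span_range_iff_exists_fun.mp hmem
  have hcoeff := congrArg (fun P : Polynomial (MvPolynomial (GraphVars n) ℂ) => P.coeff k)
    (congrArg Θ hh)
  simp only [map_sum, map_mul, map_pow, h2, Polynomial.finsetSum_coeff, Polynomial.coeff_mul,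
    Polynomial.coeff_X_add_C_pow, show k + 2 - k = 2 by omega] at hcoeff
  -- the left-hand side lies in `J`
  have key : generator n q ^ 2 * ((k + 2).choose k : MvPolynomial (GraphVars n) ℂ) ∈ J := by
    rw [← hcoeff]
    refine Ideal.sum_mem _ fun o _ => Ideal.sum_mem _ fun il hil => ?_
    rw [Finset.HasAntidiagonal.mem_antidiagonal] at hil
    exact Ideal.mul_mem_left _ _ (Ideal.subset_span ⟨(⟨il.2, by omega⟩, o), rfl⟩)
  have hc : ((k + 2).choose k : ℂ) ≠ 0 := by exact_mod_cast (Nat.choose_pos (by omega)).ne'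
  have hgen : generator n q ^ 2 = C (((k + 2).choose k : ℂ)⁻¹) *
      (generator n q ^ 2 * ((k + 2).choose k : MvPolynomial (GraphVars n) ℂ)) := by
    rw [← map_natCast (C : ℂ →+* MvPolynomial (GraphVars n) ℂ), mul_comm (generator n q ^ 2),
      ← mul_assoc, ← map_mul, inv_mul_cancel₀ hc, map_one, one_mul]
  rw [hgen]
  exact Ideal.mul_mem_left _ _ key

/-! ## The `e = 2` exact engine for a test FAMILY -/

/-- **Square members for a finite test family in `I` force the rank bound** (M19m for families): tests
`t_o ∈ I` of nonscalar length `≤ N` with `f_q² ∈ (t_o)_o` for every `q` give `R(⟨n,n,n⟩) ≤ 6N` — translate to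
a base of maximal row rank (`translate` fixes the `f_q`, keeps `I` and the nonscalar length) and apply
`tensorRank_le_of_sqMembers_at_maxRank`. -/
theorem tensorRank_le_of_sqMembers_family {N : ℕ} {ι : Type*} [Fintype ι]
    (t : ι → MvPolynomial (GraphVars n) ℂ)
    (hspan : ∃ gs : List (MvPolynomial (GraphVars n) ℂ), IsNonscalarSeq gs ∧ gs.length ≤ N ∧
      ∀ o, t o ∈ freeSpan {q | q ∈ gs})
    (ht : ∀ o, t o ∈ graphIdeal n)
    (hsq : ∀ q : Fin n × Fin n, generator n q ^ 2 ∈ Ideal.span (Set.range t)) :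
    tensorRank (matMulTensor ℂ n n n) ≤ 2 * (3 * N) := by
  classical
  -- reindex by `Fin T`
  set T := Fintype.card ι
  set e := (Fintype.equivFin ι).symm with he
  -- a base of maximal row rank
  let r : (MatMulVars n → ℂ) → ℕ := fun y =>
    (Matrix.of fun (o : Fin T) (q : Fin n × Fin n) => eval y (rowPoly (t (e o)) q)).rank
  have hbdd : BddAbove (Set.range r) := by
    exact ⟨Fintype.card (Fin n × Fin n), by rintro _ ⟨y, rfl⟩; exact Matrix.rank_le_card_width _⟩
  obtain ⟨y, hy⟩ := Nat.sSup_mem (Set.range_nonempty r) hbdd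
  have hle : ∀ y' : MatMulVars n → ℂ, r y' ≤ r y := fun y' => hy.symm ▸ le_csSup hbdd ⟨y', rfl⟩
  -- the translated, reindexed family
  set t' : Fin T → MvPolynomial (GraphVars n) ℂ := fun o => GraphEquations.translate y (t (e o))
    with ht'def
  obtain ⟨gs, hns, hlen, hfs⟩ := hspan
  obtain ⟨hns', hmem'⟩ :=
    IsNonscalarSeq.aeval_append (θ := shift (graphPoint y)) (hs := []) (shift_mem_freeSpan _)
      isNonscalarSeq_nil hns
  have hspan' : ∃ gs' : List (MvPolynomial (GraphVars n) ℂ), IsNonscalarSeq gs' ∧ gs'.length ≤ N ∧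
      ∀ o, t' o ∈ freeSpan {q | q ∈ gs'} := by
    refine ⟨gs.map (MvPolynomial.aeval (shift (graphPoint y))) ++ [], hns', by simpa using hlen,
      fun o => ?_⟩
    rw [ht'def]
    dsimp only
    rw [translate_eq, ← MvPolynomial.aeval_eq_bind₁]
    exact hmem' _ (hfs (e o))
  have ht' : ∀ o, t' o ∈ graphIdeal n := fun o => translate_mem_graphIdeal y (ht (e o))
  have hrow : ∀ y' : MatMulVars n → ℂ,
      (Matrix.of fun (o : Fin T) (q : Fin n × Fin n) => eval y' (rowPoly (t' o) q)) =
        Matrix.of fun (o : Fin T) (q : Fin n × Fin n) => eval (y' + y) (rowPoly (t (e o)) q) := by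
    intro y'; ext o q
    simp only [Matrix.of_apply, ht'def, eval_rowPoly, eval_graphPoint_pderiv_inr_translate]
  have hmax : ∀ y' : MatMulVars n → ℂ,
      (Matrix.of fun o q => eval y' (rowPoly (t' o) q)).rank ≤
        (Matrix.of fun o q => eval 0 (rowPoly (t' o) q)).rank := by
    intro y'; rw [hrow, hrow, zero_add]; exact hle _
  have hsq' : ∀ q : Fin n × Fin n, ∃ (g : MvPolynomial (MatMulVars n) ℂ)
      (h : Fin T → MvPolynomial (GraphVars n) ℂ), coeff 0 g ≠ 0 ∧
        ∑ o, h o * t' o = liftAB n g * generator n q ^ 2 := by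
    intro q
    have hrange : Set.range (t ∘ e) = Set.range t := e.surjective.range_comp t
    have hsq1 : generator n q ^ 2 ∈ Ideal.span (Set.range (t ∘ e)) := by rw [hrange]; exact hsq q
    obtain ⟨kf, hk⟩ := Ideal.mem_span_range_iff_exists_fun.mp hsq1
    refine ⟨1, fun o => GraphEquations.translate y (kf o), by simp, ?_⟩
    have h := congrArg (GraphEquations.translate y) hk
    have hg := translate_generator y q
    rw [translate_eq] at hg
    simp only [translate_eq, map_sum, map_mul, map_pow, Function.comp_apply] at h
    rw [hg] at h
    simp only [ht'def, translate_eq, map_one, one_mul]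
    exact h
  exact tensorRank_le_of_sqMembers_at_maxRank t' hspan' ht' hmax hsq'

/-! ## Every rung on tight systems, at quadratic cost -/

/-- **THE TIGHT DIAL IS QUADRATIC: `Φ(k+2) = 6·binom(k+2,2)`.**  A correct system whose tests lie in
`I^{k+1}` and with `f_q^{k+2} ∈ J_E` for every `q` satisfies `R(⟨n,n,n⟩) ≤ 6·binom(k+2,2)·cost E`:
Hasse–Schmidt AD along the vertical field puts the `binom(k+2,2)·cost` modes `[s^l]Θt_o` (`l ≤ k`, all in `I`)
in one program, and `f_q²` is among their combinations; then the `e = 2` exact engine. -/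
theorem rankRung_tight_choose (k : ℕ) {E : EqSystem n} (hE : E.Correct)
    (hdeep : ∀ j ∈ E.tests, E.testPoly j ∈ graphIdeal n ^ (k + 1))
    (hmem : ∀ q : Fin n × Fin n, generator n q ^ (k + 2) ∈
      Ideal.span (Set.range fun o : Fin E.tests.length => E.testPoly (E.tests.get o))) :
    tensorRank (matMulTensor ℂ n n n) ≤ 6 * ((k + 2).choose 2 * E.cost) := by
  classical
  obtain ⟨Θ, h0, h1, h2⟩ := exists_verticalHasse n
  obtain ⟨gs, hns, hlen, hfs⟩ := exists_isNonscalarSeq_tests E hE.1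
  obtain ⟨gs', hns', hlen', hT⟩ := IsNonscalarSeq.hasse_affine Θ h1 k hns
  have hmain : tensorRank (matMulTensor ℂ n n n) ≤ 2 * (3 * ((k + 2).choose 2 * E.cost)) := by
    refine tensorRank_le_of_sqMembers_family
      (fun lo : Fin (k + 1) × Fin E.tests.length => (Θ (E.testPoly (E.tests.get lo.2))).coeff (lo.1 : ℕ))
      ⟨gs', hns', hlen'.trans (Nat.mul_le_mul_left _ hlen), fun lo =>
        hT _ (hfs lo.2) lo.1 (Nat.lt_succ_iff.mp lo.1.isLt)⟩ (fun lo => ?_)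
      (fun q => sq_mem_span_hasseModes Θ h2 k (fun o : Fin E.tests.length => E.testPoly (E.tests.get o))
        (hmem q))
    have h := hasse_coeff_mem_pow Θ h0 (graphIdeal n) (k + 1)
      (hdeep _ (List.get_mem E.tests lo.2)) (lo.1 : ℕ)
    have hl : 1 ≤ k + 1 - (lo.1 : ℕ) := by have := lo.1.isLt; omega
    simpa only [pow_one] using Ideal.pow_le_pow_right hl h
  calc tensorRank (matMulTensor ℂ n n n) ≤ 2 * (3 * ((k + 2).choose 2 * E.cost)) := hmain
    _ = 6 * ((k + 2).choose 2 * E.cost) := by ring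

/-- The same bound in the RUNG format of the dial (M20a), `Φ(k+2) = 6·binom(k+2,2)` over `cost + n²`. -/
theorem rankRung_tight_choose' (k : ℕ) {E : EqSystem n} (hE : E.Correct)
    (hdeep : ∀ j ∈ E.tests, E.testPoly j ∈ graphIdeal n ^ (k + 1))
    (hmem : ∀ q : Fin n × Fin n, generator n q ^ (k + 2) ∈
      Ideal.span (Set.range fun o : Fin E.tests.length => E.testPoly (E.tests.get o))) :
    (tensorRank (matMulTensor ℂ n n n) : ℝ) ≤ 6 * ((k + 2).choose 2 : ℝ) * ((E.cost : ℝ) + n * n) := by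
  have h1 : (tensorRank (matMulTensor ℂ n n n) : ℝ) ≤ 6 * (((k + 2).choose 2 : ℝ) * (E.cost : ℝ)) := by
    exact_mod_cast rankRung_tight_choose k hE hdeep hmem
  have h0 : (0 : ℝ) ≤ 6 * ((k + 2).choose 2 : ℝ) * ((n : ℝ) * n) := by positivity
  nlinarith [h1, h0]

/-! ## Polynomial-growth purification (tight regime, unconditional) -/

/-- **POLYNOMIAL-GROWTH PURIFICATION.**  A family of correct TIGHT systems `E_n` (tests in `I^{k_n+1}`,
`f_q^{k_n+2} ∈ J_{E_n}`) with `binom(k_n+2,2)·cost E_n ≤ c·n^β` forces `ω ≤ β` — the membership exponent may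
grow like a power of `n`. -/
theorem omega_le_of_tight_polyGrowth {β : ℝ}
    (h : ∃ c : ℝ, ∀ n : ℕ, 1 ≤ n → ∃ (E : EqSystem n) (k : ℕ), E.Correct ∧
      (∀ j ∈ E.tests, E.testPoly j ∈ graphIdeal n ^ (k + 1)) ∧
      (∀ q : Fin n × Fin n, generator n q ^ (k + 2) ∈
        Ideal.span (Set.range fun o : Fin E.tests.length => E.testPoly (E.tests.get o))) ∧
      ((k + 2).choose 2 : ℝ) * (E.cost : ℝ) ≤ c * (n : ℝ) ^ β) :
    omega ℂ ≤ β := by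
  obtain ⟨c, hc⟩ := h
  refine omega_le_of_rank_family_le (K := 6 * c) fun n hn => ?_
  obtain ⟨E, k, hE, hdeep, hmem, hgrow⟩ := hc n hn
  have h1 : (tensorRank (matMulTensor ℂ n n n) : ℝ) ≤ 6 * (((k + 2).choose 2 : ℝ) * (E.cost : ℝ)) := by
    exact_mod_cast rankRung_tight_choose k hE hdeep hmem
  linarith

/-- **POLYNOMIAL-GROWTH PURIFICATION, admissibility form**: the same family at `β` gives
`EqAdmissibleRed β'` for every `β' > β` (the currency of `MultiplicityReduction`). -/
theorem eqAdmissibleRed_of_tight_polyGrowth {β : ℝ}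
    (h : ∃ c : ℝ, ∀ n : ℕ, 1 ≤ n → ∃ (E : EqSystem n) (k : ℕ), E.Correct ∧
      (∀ j ∈ E.tests, E.testPoly j ∈ graphIdeal n ^ (k + 1)) ∧
      (∀ q : Fin n × Fin n, generator n q ^ (k + 2) ∈
        Ideal.span (Set.range fun o : Fin E.tests.length => E.testPoly (E.tests.get o))) ∧
      ((k + 2).choose 2 : ℝ) * (E.cost : ℝ) ≤ c * (n : ℝ) ^ β) :
    ∀ β' : ℝ, β < β' → EqAdmissibleRed β' := fun _ hβ' =>
  eqAdmissibleRed_of_omega_lt ((omega_le_of_tight_polyGrowth h).trans_lt hβ')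

end Summit.MatrixMultiplication.MatrixMultiplication.Theorems.GraphEquations

end
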